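import Summits.BirchSwinnertonDyer.Rank1Residual.Iwasawa.LambdaInvariantValuation
import HarnessLib

/-!
# Crux `SprungLowerDivisibilityAtThree` (item stmt-BirchSwinnertonDyer-19875), line `chromatic-common-zeros`:
# the SLOPE-SEPARATION coprimality lemma in `Λ = ℤ_p⟦T⟧` — two elements with `μ = 0`, constant term of
# valuation exactly `1` and DIFFERENT `λ`-invariants have no common zero in the open unit disc of `ℂ_p`,
# hence no common height-one prime (pure `p`-adic algebra, any prime `p`)

Cell `bsd-ssimc` (host) / lead `cruxlead-stmt-BirchSwinnertonDyer-19875`; width seat `-w3` (gen 3);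
`--supports` 19875 `--as helper`; THEOREMS ONLY (no definition, no named fact, nothing about any curve
asserted); closes no item; BSD / K1 / leaf X8 are NOT proved by anything here.

## Why (the line's per-pair doors)

The lever S1 of the line (`ChromaticCommonZeros.stub_squeezeToCommonZeros`, p606891) reduces the crux
K1 for an X8 pair `(E, 3)` to the COMMON height-one zeros of Sprung's two chromatic `3`-adic
`L`-functions `(ϖL♯, ϖL♭)`; the census doors (R2) `…_of_noCommonZero` (p609846) and (R3)
`…_of_noCommonZeroOffT_of_analyticRank_le_one` take as input «no common height-one prime (off `(T)`)».
The x8 cell's R5 table (`pub/bsd-print-x8/ty3/data/r5/x8_r5_chromatic_n5_j299803.tsv`, 217 census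
cells) certifies that input NUMERICALLY by a `3`-adic resultant or by DISJOINT NEWTON POLYGONS. This file
proves the kernel form of the simplest disjoint-Newton-polygon certificate, which needs THREE INTEGERS
per pair and no `3`-adic approximation: if both functions have `μ = 0`, constant term of valuation
EXACTLY ONE, and `λ(L♯) ≠ λ(L♭)`, they are coprime in `Λ` (38 of the 217 cells have this shape: 20 of
analytic rank `0` and — after division by `T` — 18 of analytic rank `1`).

## What is proved (general `p`; `G(z)` denotes `∑ ι(G_k) z^k` for `|z| < 1` in `ℂ_p`)

* §1 coefficient bookkeeping at `μ(G) = 0`: `|G_k| ≤ 1/p` for `k < λ(G)` and `|G_{λ(G)}| = 1`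
  (`norm_coeff_le_inv_of_lt_lam`, `norm_coeff_lam_eq_one`).
* §2 **the constant term dominates below the critical radius**: `μ(G) = 0`, `|G(0)| = 1/p` and
  `|z|^{λ(G)} < 1/p` give `|G(z)| = 1/p` (`norm_tsum_eq_inv_of_pow_lam_lt`); with the tree's VALUATION
  THEOREM (`norm_tsum_eq_of_lt_norm_pow_lam`: `|G(z)| = |z|^{λ(G)}` when `|z|^{λ(G)} > 1/p`) every zero of
  `G` in the open disc satisfies **`|z|^{λ(G)} = 1/p`** (`norm_pow_lam_eq_inv_of_hasSum_zero`) — the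
  one-segment Newton polygon from `(0, 1)` to `(λ, 0)`: all roots have valuation `1/λ`.
* §3 **slope separation**: two such `F, G` with `λ(F) ≠ λ(G)` have no common zero in the open disc
  (`not_common_zero_of_lam_ne`).
* §4 **from points to primes**: a height-one prime `𝔭 = (f)` of `Λ`, `f` distinguished irreducible, has a
  point `z ∈ ℂ_p`, `|z| < 1`, at which every element of `𝔭` vanishes (`exists_common_zero_of_span_
  distinguished`; `ℂ_p` algebraically closed, evaluation multiplicative); hence **no height-one prime of `Λ`
  contains both `F` and `G`** (`not_mem_and_mem_of_lam_ne`: the prime `(p)` is excluded by `μ(F) = 0`, the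
  others by §3 via the tree's `IwasawaAlgebra.eq_span_of_height_eq_one`), and the `T`-shifted form for
  `F = T·F₁`, `G = T·G₁` off the prime `(T)` (`not_mem_and_mem_of_X_mul_of_lam_ne`).

The crux-facing doors (X8 pairs, Sprung pairs, (R2)/(R3)) are in the sibling file
`…SlopeSeparationDoor.lean`.

References (ATTRIBUTION; the proofs are self-contained over the tree's `p`-adic Weierstrass files):
[Washington1997] L. C. Washington, *Introduction to Cyclotomic Fields*, GTM 83, §7.1–7.2 (Prop. 7.2,
Thm. 7.3: distinguished polynomials, `p`-adic Weierstrass preparation), §13.2 (height-one primes of `Λ`);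
[Lang1990] S. Lang, *Cyclotomic Fields I and II*, Ch. 5 §2 Thm. 2.2; [Koblitz1984] N. Koblitz, *p-adic
Numbers, p-adic Analysis, and Zeta-Functions*, GTM 58, Ch. IV §3–§4 (Newton polygons of power series: the
roots of valuation `s` are counted by the segment of slope `−s`). Tree: `Rank1Residual/Iwasawa/
LambdaInvariantValuation.lean` (valuation theorem), `…/LambdaInvariantZeroSet.lean` (roots of the
distinguished factor), `Literature/…/PAdicPowerSeriesZeros.lean` (evaluation on the open disc),
`Literature/…/IwasawaAlgebraStructureProofs.lean` (`eq_span_of_height_eq_one`).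
-/

set_option autoImplicit false
-- justification: the mandated namespace `Summit.BirchSwinnertonDyer.BirchSwinnertonDyer.Theorems`
-- (single-conjunct summit, Sub = Summit) repeats a segment by design (D-0017).
set_option linter.dupNamespace false

noncomputable section

open scoped Classical

open Polynomial Literature.NumberTheory.EllipticCurves
  Summit.BirchSwinnertonDyer.Rank1Residual.X1.MuLambda
  Summit.BirchSwinnertonDyer.Rank1Residual.Iwasawa

namespace Summit.BirchSwinnertonDyer.BirchSwinnertonDyer.Theorems.ChromaticSlopeSeparation

variable {p : ℕ} [hp : Fact p.Prime]

/-! ## §1. Coefficients of an element of `Λ` with `μ = 0` -/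

section Coeff

/-- For `g ≠ 0` with `μ(g) = 0`: the reduction `ḡ ∈ 𝔽_p⟦T⟧` is nonzero and `λ(g)` is its order.
[cite: Washington1997, §7.1] -/
theorem red_ne_zero_and_lam_eq_order {g : IwasawaAlgebra p} (hg : g ≠ 0) (hμ : mu g = 0) :
    red g ≠ 0 ∧ (lam g : ℕ∞) = (red g).order := by
  have hpf : pfree g = g := by
    have h := eq_C_pow_mu_mul_pfree g
    rw [hμ, pow_zero, map_one, one_mul] at h
    exact h.symm
  have hred : red g ≠ 0 := by rw [← hpf]; exact red_pfree_ne_zero hg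
  refine ⟨hred, ?_⟩
  rw [lam, hpf]
  exact ENat.coe_toNat ((PowerSeries.order_finite_iff_ne_zero.mpr hred).ne)

/-- **Below `λ` the coefficients are divisible by `p`**: for `g ≠ 0` with `μ(g) = 0` and `k < λ(g)`,
`g_k ∈ pℤ_p`, i.e. `|ι g_k| ≤ 1/p` in `ℂ_p`. [cite: Washington1997, §7.1] -/
theorem norm_coeff_le_inv_of_lt_lam {g : IwasawaAlgebra p} (hg : g ≠ 0) (hμ : mu g = 0) {k : ℕ}
    (hk : k < lam g) :
    ‖((algebraMap ℚ_[p] ℂ_[p]).comp (algebraMap ℤ_[p] ℚ_[p])) (PowerSeries.coeff k g)‖ ≤ (p : ℝ)⁻¹ := by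
  obtain ⟨-, hord⟩ := red_ne_zero_and_lam_eq_order hg hμ
  have hlt : (k : ℕ∞) < (red g).order := by rw [← hord]; exact_mod_cast hk
  have h0 : PowerSeries.coeff k (red g) = 0 := PowerSeries.coeff_of_lt_order k hlt
  rw [PowerSeries.coeff_map, IsLocalRing.residue_eq_zero_iff] at h0
  exact norm_algebraMap_comp_le_inv_of_mem_maximalIdeal h0

/-- **The coefficient at `λ` is a unit**: for `g ≠ 0` with `μ(g) = 0`, `|ι g_{λ(g)}| = 1`.
[cite: Washington1997, §7.1] -/
theorem norm_coeff_lam_eq_one {g : IwasawaAlgebra p} (hg : g ≠ 0) (hμ : mu g = 0) :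
    ‖((algebraMap ℚ_[p] ℂ_[p]).comp (algebraMap ℤ_[p] ℚ_[p])) (PowerSeries.coeff (lam g) g)‖ = 1 := by
  obtain ⟨hred, hord⟩ := red_ne_zero_and_lam_eq_order hg hμ
  have hc : PowerSeries.coeff (lam g) (red g) ≠ 0 := by
    have h := PowerSeries.coeff_order hred
    have hn : (red g).order.toNat = lam g := by
      apply_fun ENat.toNat at hord
      simpa using hord.symm
    rw [hn] at h
    exact h
  rw [PowerSeries.coeff_map] at hc
  have hunit : IsUnit (PowerSeries.coeff (lam g) g) := by
    by_contra hnu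
    exact hc ((IsLocalRing.residue_eq_zero_iff _).mpr ((IsLocalRing.mem_maximalIdeal _).mpr hnu))
  rw [norm_algebraMap_comp_apply]
  exact PadicInt.isUnit_iff.mp hunit

/-- `|ι g_0| = ‖constantCoeff g‖`. [folklore] -/
theorem norm_coeff_zero_eq (g : IwasawaAlgebra p) :
    ‖((algebraMap ℚ_[p] ℂ_[p]).comp (algebraMap ℤ_[p] ℚ_[p])) (PowerSeries.coeff 0 g)‖ =
      ‖PowerSeries.constantCoeff g‖ := by
  rw [PowerSeries.coeff_zero_eq_constantCoeff_apply, norm_algebraMap_comp_apply]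

/-- If `|g(0)| = 1/p` and `μ(g) = 0` then `λ(g) ≥ 1` (the constant term is not a unit).
[cite: Washington1997, §7.1] -/
theorem one_le_lam_of_norm_constantCoeff_eq_inv {g : IwasawaAlgebra p} (hg : g ≠ 0) (hμ : mu g = 0)
    (h0 : ‖PowerSeries.constantCoeff g‖ = (p : ℝ)⁻¹) : 1 ≤ lam g := by
  by_contra hlt
  rw [not_le, Nat.lt_one_iff] at hlt
  have h1 := norm_coeff_lam_eq_one hg hμ
  rw [hlt, norm_coeff_zero_eq, h0] at h1
  exact absurd h1 (inv_prime_pos_and_lt_one (p := p)).2.ne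

end Coeff

/-! ## §2. One function: the constant term dominates below the critical radius -/

section OneFunction

/-- **Below the critical radius the constant term dominates.** For `G ∈ Λ ∖ {0}` with `μ(G) = 0`,
`|G(0)| = 1/p`, and `|z| < 1` with `|z|^{λ(G)} < 1/p`: `|G(z)| = 1/p`. Indeed the term `k = 0` has
absolute value `1/p`; for `1 ≤ k < λ(G)`, `|G_k z^k| ≤ (1/p)|z| < 1/p`; for `k ≥ λ(G)`,
`|G_k z^k| ≤ |z|^{λ(G)} < 1/p`; ultrametric equality. [cite: Washington1997, §7.1–7.2]
[cite: Koblitz1984, Ch. IV §4 (Newton polygon of a power series)] -/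
theorem norm_tsum_eq_inv_of_pow_lam_lt {G : IwasawaAlgebra p} (hG0 : G ≠ 0) (hμ : mu G = 0)
    (h0 : ‖PowerSeries.constantCoeff G‖ = (p : ℝ)⁻¹) {z : ℂ_[p]} (hz : ‖z‖ < 1)
    (hlt : ‖z‖ ^ lam G < (p : ℝ)⁻¹) :
    ‖∑' k, ((algebraMap ℚ_[p] ℂ_[p]).comp (algebraMap ℤ_[p] ℚ_[p])) (PowerSeries.coeff k G) *
        z ^ k‖ = (p : ℝ)⁻¹ := by
  set ιZ : ℤ_[p] →+* ℂ_[p] := (algebraMap ℚ_[p] ℂ_[p]).comp (algebraMap ℤ_[p] ℚ_[p]) with hιZ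
  set a : ℕ → ℂ_[p] := fun k ↦ ιZ (PowerSeries.coeff k G) * z ^ k with ha
  have hbd : ∀ k, ‖ιZ (PowerSeries.coeff k G)‖ ≤ 1 := norm_algebraMap_coeff_le_one G
  have hsum : Summable a := summable_map_coeff_mul_pow ιZ hbd hz
  obtain ⟨hq0, hq1⟩ := inv_prime_pos_and_lt_one (p := p)
  have hlam1 : 1 ≤ lam G := one_le_lam_of_norm_constantCoeff_eq_inv hG0 hμ h0
  -- the uniform bound on the tail: `δ = max((1/p)·|z|, |z|^λ) < 1/p`
  set δ : ℝ := max ((p : ℝ)⁻¹ * ‖z‖) (‖z‖ ^ lam G) with hδ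
  have hδlt : δ < (p : ℝ)⁻¹ := by
    refine max_lt ?_ hlt
    calc (p : ℝ)⁻¹ * ‖z‖ < (p : ℝ)⁻¹ * 1 := mul_lt_mul_of_pos_left hz hq0
      _ = (p : ℝ)⁻¹ := mul_one _
  have hδ0 : 0 ≤ δ := le_trans (pow_nonneg (norm_nonneg _) _) (le_max_right _ _)
  have htail : ∀ k, ‖a (k + 1)‖ ≤ δ := by
    intro k
    rw [ha]
    dsimp only
    rw [norm_mul, norm_pow]
    by_cases hk : k + 1 < lam G
    · -- `|G_{k+1}| ≤ 1/p` and `|z|^{k+1} ≤ |z|`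
      calc ‖ιZ (PowerSeries.coeff (k + 1) G)‖ * ‖z‖ ^ (k + 1)
          ≤ (p : ℝ)⁻¹ * ‖z‖ := by
            refine mul_le_mul (norm_coeff_le_inv_of_lt_lam hG0 hμ hk) ?_
              (pow_nonneg (norm_nonneg _) _) hq0.le
            calc ‖z‖ ^ (k + 1) ≤ ‖z‖ ^ 1 := pow_le_pow_of_le_one (norm_nonneg _) hz.le (by omega)
              _ = ‖z‖ := pow_one _
        _ ≤ δ := le_max_left _ _
    · -- `|G_{k+1}| ≤ 1` and `|z|^{k+1} ≤ |z|^λ`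
      rw [not_lt] at hk
      calc ‖ιZ (PowerSeries.coeff (k + 1) G)‖ * ‖z‖ ^ (k + 1)
          ≤ 1 * ‖z‖ ^ lam G :=
            mul_le_mul (hbd _) (pow_le_pow_of_le_one (norm_nonneg _) hz.le hk)
              (pow_nonneg (norm_nonneg _) _) zero_le_one
        _ = ‖z‖ ^ lam G := one_mul _
        _ ≤ δ := le_max_right _ _
  have htail' : ‖∑' k, a (k + 1)‖ ≤ δ :=
    IsUltrametricDist.norm_tsum_le_of_forall_le_of_nonneg hδ0 htail
  have ha0 : ‖a 0‖ = (p : ℝ)⁻¹ := by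
    rw [ha]
    dsimp only
    rw [pow_zero, mul_one, norm_coeff_zero_eq, h0]
  have hne : ‖a 0‖ ≠ ‖∑' k, a (k + 1)‖ := by
    rw [ha0]
    exact (ne_of_lt (lt_of_le_of_lt htail' hδlt)).symm
  rw [hsum.tsum_eq_zero_add, IsUltrametricDist.norm_add_eq_max_of_norm_ne_norm hne, ha0]
  exact max_eq_left (le_trans htail' hδlt.le)

/-- **The one-segment Newton polygon.** For `G ∈ Λ ∖ {0}` with `μ(G) = 0` and `|G(0)| = 1/p`,
every zero `z` of `G` in the open unit disc of `ℂ_p` satisfies **`|z|^{λ(G)} = 1/p`**: above the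
critical radius `|G(z)| = |z|^{λ(G)} ≠ 0` (the tree's valuation theorem), below it `|G(z)| = 1/p ≠ 0`
(§2). [cite: Washington1997, §7.1–7.2 and Thm. 7.3] [cite: Koblitz1984, Ch. IV §4 (Newton polygon of a power series)] -/
theorem norm_pow_lam_eq_inv_of_hasSum_zero {G : IwasawaAlgebra p} (hG0 : G ≠ 0) (hμ : mu G = 0)
    (h0 : ‖PowerSeries.constantCoeff G‖ = (p : ℝ)⁻¹) {z : ℂ_[p]} (hz : ‖z‖ < 1)
    (hsum : HasSum (fun k ↦ ((algebraMap ℚ_[p] ℂ_[p]).comp (algebraMap ℤ_[p] ℚ_[p]))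
      (PowerSeries.coeff k G) * z ^ k) 0) :
    ‖z‖ ^ lam G = (p : ℝ)⁻¹ := by
  have hval : ‖∑' k, ((algebraMap ℚ_[p] ℂ_[p]).comp (algebraMap ℤ_[p] ℚ_[p]))
      (PowerSeries.coeff k G) * z ^ k‖ = 0 := by rw [hsum.tsum_eq, norm_zero]
  obtain ⟨hq0, -⟩ := inv_prime_pos_and_lt_one (p := p)
  rcases lt_trichotomy (‖z‖ ^ lam G) ((p : ℝ)⁻¹) with hlt | heq | hgt
  · -- below the critical radius: `|G(z)| = 1/p ≠ 0`
    rw [norm_tsum_eq_inv_of_pow_lam_lt hG0 hμ h0 hz hlt] at hval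
    exact absurd hval hq0.ne'
  · exact heq
  · -- above the critical radius: `|G(z)| = |z|^λ ≠ 0`
    rw [norm_tsum_eq_of_lt_norm_pow_lam hG0 hz hgt, hμ, pow_zero, one_mul] at hval
    exact absurd hval (lt_trans hq0 hgt).ne'

end OneFunction

/-! ## §3. Two functions: slope separation -/

section TwoFunctions

/-- **SLOPE SEPARATION.** For `F, G ∈ Λ ∖ {0}` with `μ(F) = μ(G) = 0`, `|F(0)| = |G(0)| = 1/p` and
`λ(F) ≠ λ(G)`, no `z` of the open unit disc of `ℂ_p` is a common zero: it would have
`|z|^{λ(F)} = 1/p = |z|^{λ(G)}` with `0 < |z| < 1`, forcing `λ(F) = λ(G)`.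
[cite: Washington1997, §7.1–7.2 and Thm. 7.3] [cite: Koblitz1984, Ch. IV §4 (Newton polygon of a power series)] -/
theorem not_common_zero_of_lam_ne {F G : IwasawaAlgebra p} (hF0 : F ≠ 0) (hG0 : G ≠ 0)
    (hμF : mu F = 0) (hμG : mu G = 0)
    (hF : ‖PowerSeries.constantCoeff F‖ = (p : ℝ)⁻¹) (hG : ‖PowerSeries.constantCoeff G‖ = (p : ℝ)⁻¹)
    (hne : lam F ≠ lam G) {z : ℂ_[p]} (hz : ‖z‖ < 1)
    (hFz : HasSum (fun k ↦ ((algebraMap ℚ_[p] ℂ_[p]).comp (algebraMap ℤ_[p] ℚ_[p]))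
      (PowerSeries.coeff k F) * z ^ k) 0)
    (hGz : HasSum (fun k ↦ ((algebraMap ℚ_[p] ℂ_[p]).comp (algebraMap ℤ_[p] ℚ_[p]))
      (PowerSeries.coeff k G) * z ^ k) 0) : False := by
  have hF' := norm_pow_lam_eq_inv_of_hasSum_zero hF0 hμF hF hz hFz
  have hG' := norm_pow_lam_eq_inv_of_hasSum_zero hG0 hμG hG hz hGz
  obtain ⟨hq0, hq1⟩ := inv_prime_pos_and_lt_one (p := p)
  -- `0 < |z|`: otherwise `|z|^{λ(F)} = 0` (`λ(F) ≥ 1`)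
  have hlamF : 1 ≤ lam F := one_le_lam_of_norm_constantCoeff_eq_inv hF0 hμF hF
  have hz0 : 0 < ‖z‖ := by
    by_contra hle
    rw [not_lt] at hle
    have h00 : ‖z‖ = 0 := le_antisymm hle (norm_nonneg _)
    rw [h00, zero_pow (by omega)] at hF'
    exact absurd hF' hq0.ne
  have hinj : Function.Injective (fun n : ℕ ↦ ‖z‖ ^ n) := pow_right_injective₀ hz0 hz.ne
  exact hne (hinj (hF'.trans hG'.symm))

end TwoFunctions

/-! ## §4. From common zeros in `ℂ_p` to common height-one primes of `Λ` -/

section Primes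

/-- **Every element of the prime `(f)`, `f ∈ ℤ_p[T]` distinguished and irreducible, vanishes at some
point of the open unit disc of `ℂ_p`**: `f` has positive degree (irreducible, monic), so a root
`z ∈ ℂ_p` (algebraically closed); `|z| < 1` (roots of distinguished polynomials); and `H = f·Q`
gives `H(z) = f(z)·Q(z) = 0` (evaluation on the open disc is multiplicative).
[cite: Washington1997, §7.1 Prop. 7.2 and §13.2] -/
theorem exists_common_zero_of_span_distinguished {f : ℤ_[p][X]}
    (hf : f.IsDistinguishedAt (IsLocalRing.maximalIdeal ℤ_[p])) (hirr : Irreducible f) :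
    ∃ z : ℂ_[p], ‖z‖ < 1 ∧ ∀ H ∈ Ideal.span {(f : IwasawaAlgebra p)},
      HasSum (fun k ↦ ((algebraMap ℚ_[p] ℂ_[p]).comp (algebraMap ℤ_[p] ℚ_[p]))
        (PowerSeries.coeff k H) * z ^ k) 0 := by
  set ιZ : ℤ_[p] →+* ℂ_[p] := (algebraMap ℚ_[p] ℂ_[p]).comp (algebraMap ℤ_[p] ℚ_[p]) with hιZ
  have hbd : ∀ (A : PowerSeries ℤ_[p]) (k : ℕ), ‖ιZ (PowerSeries.coeff k A)‖ ≤ 1 :=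
    norm_algebraMap_coeff_le_one
  have hmonic : f.Monic := hf.monic
  -- `f` has positive degree
  have hdeg : 0 < (f.map ιZ).degree := by
    rw [degree_map_eq_of_injective injective_algebraMap_comp]
    rcases lt_or_ge 0 f.degree with h | h
    · exact h
    · exfalso
      have hdeg0 : f.natDegree = 0 := natDegree_eq_zero_iff_degree_le_zero.mpr h
      have hf1 : f = 1 := eq_one_of_monic_natDegree_zero hmonic hdeg0
      exact hirr.not_isUnit (hf1 ▸ isUnit_one)
  -- a root in `ℂ_p`, inside the open disc
  obtain ⟨z, hz⟩ := IsAlgClosed.exists_root (f.map ιZ) hdeg.ne'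
  rw [IsRoot.def, eval_map] at hz
  have hz1 : ‖z‖ < 1 := norm_lt_one_of_eval₂_eq_zero_of_isDistinguishedAt hf hz
  refine ⟨z, hz1, fun H hH ↦ ?_⟩
  obtain ⟨Q, rfl⟩ := Ideal.mem_span_singleton'.mp hH
  have hsummable := summable_map_coeff_mul_pow ιZ (hbd (Q * (f : IwasawaAlgebra p))) hz1
  have hval : ∑' k, ιZ (PowerSeries.coeff k (Q * (f : IwasawaAlgebra p))) * z ^ k = 0 := by
    rw [tsum_map_coeff_mul_mul_pow ιZ (hbd _) (hbd _) hz1,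
      (hasSum_map_coeff_coe_mul_pow ιZ f z).tsum_eq, hz, mul_zero]
  rw [← hval]
  exact hsummable.hasSum

/-- **NO COMMON HEIGHT-ONE PRIME.** For `F, G ∈ Λ ∖ {0}` with `μ(F) = μ(G) = 0`,
`|F(0)| = |G(0)| = 1/p` and `λ(F) ≠ λ(G)`: no height-one prime of `Λ = ℤ_p⟦T⟧` contains both `F` and
`G`. A height-one prime is `(p)` — excluded since `p ∣ F` would force `μ(F) ≥ 1` — or `(f)` with `f`
distinguished irreducible, whose common zero `z` (§4) would be a common zero of `F` and `G` (§3).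
[cite: Washington1997, §7.1–7.2, Thm. 7.3 and §13.2] [cite: Koblitz1984, Ch. IV §4 (Newton polygon of a power series)] -/
theorem not_mem_and_mem_of_lam_ne {F G : IwasawaAlgebra p} (hF0 : F ≠ 0) (hG0 : G ≠ 0)
    (hμF : mu F = 0) (hμG : mu G = 0)
    (hF : ‖PowerSeries.constantCoeff F‖ = (p : ℝ)⁻¹) (hG : ‖PowerSeries.constantCoeff G‖ = (p : ℝ)⁻¹)
    (hne : lam F ≠ lam G) (𝔭 : PrimeSpectrum (IwasawaAlgebra p)) (h𝔭 : 𝔭.asIdeal.height = 1) :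
    ¬ (F ∈ 𝔭.asIdeal ∧ G ∈ 𝔭.asIdeal) := by
  rintro ⟨hF𝔭, hG𝔭⟩
  rcases IwasawaAlgebra.eq_span_of_height_eq_one p 𝔭.asIdeal h𝔭 with hp𝔭 | ⟨f, hf, hirr, hf𝔭⟩
  · -- `𝔭 = (p)`: contradicts `μ(F) = 0`
    rw [hp𝔭, Ideal.mem_span_singleton] at hF𝔭
    have h1 : 1 ≤ mu F := le_mu_of_C_pow_dvd hF0 (by rwa [pow_one])
    omega
  · -- `𝔭 = (f)`: a common zero in `ℂ_p`
    obtain ⟨z, hz, hzero⟩ := exists_common_zero_of_span_distinguished hf hirr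
    rw [hf𝔭] at hF𝔭 hG𝔭
    exact not_common_zero_of_lam_ne hF0 hG0 hμF hμG hF hG hne hz (hzero F hF𝔭) (hzero G hG𝔭)

/-- **The `T`-shifted form (analytic rank one).** If `F = T·F₁` and `G = T·G₁` with `F₁, G₁` as in
`not_mem_and_mem_of_lam_ne` (`μ = 0`, `|F₁(0)| = |G₁(0)| = 1/p`, `λ(F₁) ≠ λ(G₁)`), then no height-one
prime of `Λ` OTHER THAN `(T)` contains both `F` and `G`. [cite: Washington1997, §7.1–7.2, Thm. 7.3 and §13.2] -/
theorem not_mem_and_mem_of_X_mul_of_lam_ne {F G F₁ G₁ : IwasawaAlgebra p}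
    (hFF : F = PowerSeries.X * F₁) (hGG : G = PowerSeries.X * G₁) (hF0 : F₁ ≠ 0) (hG0 : G₁ ≠ 0)
    (hμF : mu F₁ = 0) (hμG : mu G₁ = 0)
    (hF : ‖PowerSeries.constantCoeff F₁‖ = (p : ℝ)⁻¹) (hG : ‖PowerSeries.constantCoeff G₁‖ = (p : ℝ)⁻¹)
    (hne : lam F₁ ≠ lam G₁) (𝔭 : PrimeSpectrum (IwasawaAlgebra p)) (h𝔭 : 𝔭.asIdeal.height = 1)
    (hT : (PowerSeries.X : IwasawaAlgebra p) ∉ 𝔭.asIdeal) :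
    ¬ (F ∈ 𝔭.asIdeal ∧ G ∈ 𝔭.asIdeal) := by
  rintro ⟨hF𝔭, hG𝔭⟩
  rw [hFF] at hF𝔭
  rw [hGG] at hG𝔭
  have hF₁ : F₁ ∈ 𝔭.asIdeal := (𝔭.isPrime.mem_or_mem hF𝔭).resolve_left hT
  have hG₁ : G₁ ∈ 𝔭.asIdeal := (𝔭.isPrime.mem_or_mem hG𝔭).resolve_left hT
  exact not_mem_and_mem_of_lam_ne hF0 hG0 hμF hμG hF hG hne 𝔭 h𝔭 ⟨hF₁, hG₁⟩

/-- **`μ` and `λ` of the `T`-quotient.** If `F = T·F₁ ≠ 0` then `F₁ ≠ 0`, `μ(F₁) = μ(F)`,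
`λ(F) = λ(F₁) + 1` and `F₁(0) = F_1` (the linear coefficient of `F`). [cite: Washington1997, §7.1] -/
theorem mu_lam_of_eq_X_mul {F F₁ : IwasawaAlgebra p} (hFF : F = PowerSeries.X * F₁) (hF0 : F ≠ 0) :
    F₁ ≠ 0 ∧ mu F₁ = mu F ∧ lam F = lam F₁ + 1 ∧ PowerSeries.constantCoeff F₁ = PowerSeries.coeff 1 F := by
  have hF₁0 : F₁ ≠ 0 := by rintro rfl; exact hF0 (by rw [hFF, mul_zero])
  have hX0 : (PowerSeries.X : IwasawaAlgebra p) ≠ 0 := PowerSeries.X_ne_zero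
  have hμX : mu (PowerSeries.X : IwasawaAlgebra p) = 0 := by
    -- `p ∤ T` in `Λ`: the reduction of `T` mod `p` is `T ≠ 0`
    by_contra hne
    have h1 : mu (PowerSeries.X : IwasawaAlgebra p) ≠ 0 := hne
    have hdvd : PowerSeries.C (p : ℤ_[p]) ∣ (PowerSeries.X : IwasawaAlgebra p) := by
      have h := C_pow_mu_dvd hX0
      rw [C_pow_eq] at h
      exact dvd_trans (dvd_pow_self _ h1) h
    have hred : red (PowerSeries.X : IwasawaAlgebra p) = 0 := (red_eq_zero_iff _).mpr hdvd
    rw [red, PowerSeries.map_X] at hred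
    exact PowerSeries.X_ne_zero hred
  have hlamX : lam (PowerSeries.X : IwasawaAlgebra p) = 1 := by
    have h := lam_X_pow (p := p) 1
    rwa [pow_one] at h
  refine ⟨hF₁0, ?_, ?_, ?_⟩
  · rw [hFF, mu_mul hX0 hF₁0, hμX, zero_add]
  · rw [hFF, lam_mul hX0 hF₁0, hlamX, add_comm]
  · rw [hFF, ← PowerSeries.coeff_zero_eq_constantCoeff_apply, PowerSeries.coeff_succ_X_mul]

end Primes

end Summit.BirchSwinnertonDyer.BirchSwinnertonDyer.Theorems.ChromaticSlopeSeparation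

end
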